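import Summits.BirchSwinnertonDyer.Rank1Residual.X11b.BDPRouteEndState
import Summits.BirchSwinnertonDyer.Rank1Residual.X11b.Three.ClassRecordEP
import HarnessLib

/-!
# Rung K2 LEAVES (D-0059 ∕ D-0061): «STEP L at `p ∥ N`, rank 1» as two CLOSED statements

Cell `bsd-stepL` (planner g18's SUB-STATEMENT PROPOSAL of 2026-08-25 18:54Z, re-shaped as RUNG
LEAVES under the coordinator ruling D-0061: routes close a registered leaf of the summit via the
gate's `--closes-target <leaf FQN>`). STATEMENTS + two re-packaging THEOREMS; nothing asserted;
no `sorry`; every open input stays a HYPOTHESIS of the theorems (never baked into a leaf).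

Two CLOSED Props over existing tree declarations, one per kernel record of class X11b
(`ClassX11b W p := r_an(E) = 1 ∧ p ≠ 2 ∧ mult(p) ∧ irr(p)`, `Partition/Rows.lean`;
`BSDp W p` = Miller's `BSD(E,p)`, `Literature/…/BSDRootNumberSmallConductorProofs.lean`):

* **K2a `X11b.MultiplicativeRankOne`** := `∀ (E,p) ∈ X11b, p ≥ 5 → BSD(E,p)` — the OUTPUT form of
  the rung at `p ≥ 5` on the WHOLE class (not the Locus-only `X11b.Statement`, which leaves the
  `p ∣ ∏ c_ℓ`, `¬(ram)` and `¬surj` atoms outside). Supplied (modulo PUBLISHED named facts) by the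
  typed inputs of `P2.bsdp_of_onTree_endState` (`X11b/BDPRouteEndState.lean`): (T1ᵗ-IMC)
  `P2OpenInputOnTreeAt` = THE open input, STEP L in the ERRATUM currency [deciding], (T2α′),
  (T2♯-ℝ) `P2ShimuraDisplaysAt`, (T3) the X11a main-conjecture half (ladder rung K6 ∕ B3's object),
  (T4′) the non-surjective corner — `multiplicativeRankOne_of_endState` below.
* **K2b `X11b.MultiplicativeRankOneAtThree`** := `∀ E, (E,3) ∈ X11b → BSD(E,3)` — the rung at
  `p = 3`. Supplied (modulo PUBLISHED named facts) by the typed inputs of the class record v4.5′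
  `Three.forall_bsdp_of_classRecord_v45'` (`X11b/Three/ClassRecordEP.lean`): road (a)
  `ClassClosure.RegulatorNonvanishingAt W 3` (Schneider at 3 = rung I1's object), roads (b)/(d)
  `Three.HsiehDescentAt₃`, `Three.BDPValueAt₃ ∧ Three.IMCDivAt₃`, `P2ShimuraDisplaysAt W 3`, the
  (T2′)₃ Euler-system halves, the (T4″)₃ corner — `multiplicativeRankOneAtThree_of_classRecord` below.

`X11b.MultiplicativeRankOne ∧ X11b.MultiplicativeRankOneAtThree` is BSD(E,p) on ALL of X11b
(`ClassX11b` forces `p` odd). Neither leaf is a theorem of the published record (RESIDUAL-CASES §a.2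
row X11b; Castella 2018 Thm. 4.4 withdrawn at `p ∥ N`; at `p = 3` no printed road); both are
conjecture-tagged bare statements consumed only as conclusions ∕ hypotheses.
-/

noncomputable section

open scoped Classical

open WeierstrassCurve NumberField IsDedekindDomain Field
open Literature.NumberTheory.EllipticCurves Literature.NumberTheory.EllipticCurves.GreenbergSelmer
  Rat.HeightOneSpectrum
  Literature.NumberTheory.DiophantineGeometry
  Literature.NumberTheory.EllipticCurves.ModularForms
  Literature.NumberTheory.EllipticCurves.Rank1Residual
  Literature.NumberTheory.EllipticCurves.Rank1Residual.Typed
  Literature.NumberTheory.EllipticCurves.Wuthrich2014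
  Literature.NumberTheory.EllipticCurves.BalakrishnanEtAl2019
  Literature.NumberTheory.EllipticCurves.Skinner2016
  Literature.NumberTheory.EllipticCurves.SteinWuthrich2013
  Literature.NumberTheory.EllipticCurves.Disegni2020
  Literature.NumberTheory.EllipticCurves.BarriosEtAl2025
  Literature.NumberTheory.QuadraticFields.Quadratic
  Literature.NumberTheory.Automorphic
  Literature.NumberTheory.GaloisRepresentations Literature.NumberTheory.GaloisCohomology
  Summit.BirchSwinnertonDyer.Rank1Residual.X11b.AcSelmer
  Summit.BirchSwinnertonDyer.Rank1Residual.X11b.LocBridge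

namespace Summit.BirchSwinnertonDyer.Rank1Residual.X11b

/-! ### §1. The two rung-K2 leaves (closed Props; conjecture-tagged, nothing asserted) -/

/-- **Rung K2a leaf — `X11b.MultiplicativeRankOne`.** For every elliptic curve `E/ℚ` (globally
minimal model `W`) and every prime `p ≥ 5` of multiplicative reduction with `r_an(E) = 1` and `E[p]`
irreducible — i.e. every pair of class X11b at `p ≥ 5` — Miller's `BSD(E,p)` holds (the `p`-part of
the Birch and Swinnerton-Dyer formula; rank part and finiteness of `Ш[p^∞]` included). NOT a theorem
of the published record at `p ∥ N` (Castella 2018 Thm. 4.4 withdrawn; JSW17 §7.4.4 (v) prose only);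
a bare statement consumed as a conclusion (`multiplicativeRankOne_of_endState`) or a hypothesis;
nothing asserted. [cite: JetchevSkinnerWan2017, §7.4.4 (v) ("The condition that p be a prime of good reduction can likely be relaxed to at least a prime of multiplicative reduction"; prose, nothing asserted)] -/
@[conjecture] def MultiplicativeRankOne : Prop :=
  ∀ (W : WeierstrassCurve ℚ) [W.IsElliptic] [W.IsGloballyMinimal] (p : ℕ) [Fact p.Prime],
    ClassX11b W p → 5 ≤ p → BSDp W p

/-- **Rung K2b leaf — `X11b.MultiplicativeRankOneAtThree`.** For every elliptic curve `E/ℚ`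
(globally minimal model `W`) with multiplicative reduction at `3`, `r_an(E) = 1` and `E[3]`
irreducible — every pair of class X11b at `p = 3` — Miller's `BSD(E,3)` holds. NOT a theorem of the
published record (no printed road at `p = 3 ∥ N`: JSW17 ∕ Castella 2018 ∕ Skinner–Zhang 2014 all
assume `p ≥ 5`); a bare statement consumed as a conclusion
(`multiplicativeRankOneAtThree_of_classRecord`) or a hypothesis; nothing asserted. [cite: JetchevSkinnerWan2017, §7.4.4 (v) (prose on relaxing the reduction type at p; nothing asserted)] -/
@[conjecture] def MultiplicativeRankOneAtThree : Prop :=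
  ∀ (W : WeierstrassCurve ℚ) [W.IsElliptic] [W.IsGloballyMinimal], ClassX11b W 3 → BSDp W 3

/-! ### §2. The leaves from the typed inputs of the kernel records (route `closes` shapes) -/

/-- **K2a leaf from the end state**: `X11b.MultiplicativeRankOne` from the fifteen PUBLISHED ∕
textbook named facts and the five typed inputs of `P2.bsdp_of_onTree_endState` — a re-packaging of
that theorem, nothing more (the shape of a D-0059 route's `closes`). CONDITIONAL on every binder;
nothing booked. [folklore] -/
theorem multiplicativeRankOne_of_endState
    -- published inputs (named facts of the tree) — route SUPPORT items
    (hGZ : ∀ (N : ℕ) [NeZero N] (W : WeierstrassCurve ℚ) (K : Type) [Field K] [NumberField K],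
      gross_zagier N W K)
    (hKo : ∀ (N : ℕ) [NeZero N] (W : WeierstrassCurve ℚ) (K : Type) [Field K] [NumberField K],
      kolyvagin N W K)
    (hB : ∀ (N : ℕ) [NeZero N] (W : WeierstrassCurve ℚ) (K : Type) [Field K] [NumberField K],
      Kolyvagin1990_padicValNat_card_sha_le N W K)
    (hSk : Skinner2016.thmC_padicValRat_bsd_rank_zero) (hWu : sha_dvd_analyticSha)
    (hGZK : rank_eq_analyticRank_of_analyticRank_le_one) (hmod : hasEntireLFunction_rat)
    (hnf : exists_isNewformOf) (hHL : HoffsteinLuo1997_exists_twist_L_one_ne_zero)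
    (hFHs : friedbergHoffstein_exists_heegnerField_split_twist_ne_zero)
    (hMaz : mazur_not_dvd_maninConstant_of_odd)
    (hBDMTV : thm12_not_le_normalizer_splitCartan)
    (hFH : friedbergHoffstein_exists_twist_ne_zero_inertAt)
    (hPT : ∀ (K : Type) [Field K] [NumberField K], poitouTate_sum_localTatePairing_eq_zero K)
    (hEP : ∀ (K : Type) [Field K] [NumberField K] (v : HeightOneSpectrum (𝓞 K)),
      localEulerPoincareCharacteristic (v.adicCompletion K))
    -- CRUX 1 (deciding; T1ᵗ-IMC) THE open input, STEP L in the erratum currency, at every pair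
    (hA : ∀ (W : WeierstrassCurve ℚ) [W.IsElliptic] [W.IsGloballyMinimal] (p : ℕ) [Fact p.Prime],
      P2OpenInputOnTreeAt W p)
    -- CRUX 2 (T2α′) the Euler-system half off the Locus
    (hUα : ∀ (W : WeierstrassCurve ℚ) [W.IsElliptic] [W.IsGloballyMinimal] (p : ℕ) [Fact p.Prime],
      ClassX11b W p → 5 ≤ p → p ∣ W.tamagawaProduct →
      (¬ Ram W p ∨ (W.HasSplitMultiplicativeReductionAtPrime p ∧
        p ∣ padicValInt p W.minimalDiscriminantInt)) → Typed.MissingUpperBoundAt W p)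
    -- CRUX 3 (T2♯-ℝ) the Shimura displays
    (hSh : ∀ (W : WeierstrassCurve ℚ) [W.IsElliptic] [W.IsGloballyMinimal] (p : ℕ) [Fact p.Prime],
      ClassX11b W p → 5 ≤ p → P2ShimuraDisplaysAt W p)
    -- CRUX 4 (T3) the main-conjecture half on the rank-0 sister class X11a (shared with K6/B3)
    (hX11a : ∀ (Wd : WeierstrassCurve ℚ) [Wd.IsElliptic] [Wd.IsGloballyMinimal] (p : ℕ)
      [Fact p.Prime], ClassX11a Wd p → Typed.MissingLowerBoundAt Wd p)
    -- CRUX 5 (T4′) the localised non-surjective corner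
    (hCorner : ∀ (W : WeierstrassCurve ℚ) [W.IsElliptic] [W.IsGloballyMinimal] (p : ℕ)
      [Fact p.Prime], ClassX11b W p → ¬ Surj W p → (p = 5 ∨ p = 7) →
        p ∣ padicValInt p W.minimalDiscriminantInt → ¬ Ram W p → Typed.MissingPPartAt W p) :
    MultiplicativeRankOne :=
  fun W _ _ p _ hX hp5 ↦
    P2.bsdp_of_onTree_endState hGZ hKo hB hSk hWu hGZK hmod hnf hHL hFHs hMaz hBDMTV hFH hPT hEP hA
      hUα hSh hX11a hCorner W p hX hp5

/-- **K2b leaf from the class record v4.5′**: `X11b.MultiplicativeRankOneAtThree` from the twenty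
PUBLISHED named facts and the typed inputs of `Three.forall_bsdp_of_classRecord_v45'` — a
re-packaging of that theorem, nothing more (the shape of a D-0059 route's `closes`). CONDITIONAL on
every binder; nothing booked. [folklore] -/
theorem multiplicativeRankOneAtThree_of_classRecord
    -- PUBLISHED: the named facts of route p2, WITHOUT `hEP` — route SUPPORT items
    (hGZ : ∀ (N : ℕ) [NeZero N] (W : WeierstrassCurve ℚ) (K : Type) [Field K] [NumberField K],
      gross_zagier N W K)
    (hKo : ∀ (N : ℕ) [NeZero N] (W : WeierstrassCurve ℚ) (K : Type) [Field K] [NumberField K],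
      kolyvagin N W K)
    (hB : ∀ (N : ℕ) [NeZero N] (W : WeierstrassCurve ℚ) (K : Type) [Field K] [NumberField K],
      Kolyvagin1990_padicValNat_card_sha_le N W K)
    (hSk : Skinner2016.thmC_padicValRat_bsd_rank_zero) (hWu : sha_dvd_analyticSha)
    (hGZK : rank_eq_analyticRank_of_analyticRank_le_one) (hmod : hasEntireLFunction_rat)
    (hnf : exists_isNewformOf) (hHL : HoffsteinLuo1997_exists_twist_L_one_ne_zero)
    (hMaz : mazur_not_dvd_maninConstant_of_odd)
    (hPT : ∀ (K : Type) [Field K] [NumberField K], poitouTate_sum_localTatePairing_eq_zero K)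
    (hFH : friedbergHoffstein_exists_twist_ne_zero_inertAt)
    (hBR : localTamagawaNumber_quadraticTwist_two_mem_of_goodReduction)
    (hSkA : thmA_charIdeal_multiplicative) (hJn : thm61_nonsplitMultiplicative)
    (hHn : exists_isMultCanonical) (hD : thm1_padicBSD_rankOne_multiplicative)
    (hpar : nonempty_modularParametrizationData)
    (hMN : ∀ (N : ℕ) [NeZero N] (W : WeierstrassCurve ℚ) (K : Type) [Field K] [NumberField K],
      MatarNekovar2019.thm03_padicValNat_card_sha_le_of_irreducible N W K)
    (hH : hsieh2014_exists_anticyclotomicPAdicLFunction)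
    -- CRUX 1 — ROAD (a) NONSPLIT(3) ∧ (ram): Schneider at 3 (rung I1's object, shared by name)
    (hReg : ∀ (W : WeierstrassCurve ℚ) [W.IsElliptic] [W.IsGloballyMinimal],
      ClassX11b W 3 → Ram W 3 → ¬ W.HasSplitMultiplicativeReductionAtPrime 3 →
        ClassClosure.RegulatorNonvanishingAt W 3)
    -- CRUX 2 — ROADS (b)/(d): the named descent residual (H1-side) …
    (hDb : ∀ (W : WeierstrassCurve ℚ) [W.IsElliptic] [W.IsGloballyMinimal],
      ClassX11b W 3 → Ram W 3 → W.HasSplitMultiplicativeReductionAtPrime 3 → Three.HsiehDescentAt₃ W)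
    (hDd : ∀ (W : WeierstrassCurve ℚ) [W.IsElliptic] [W.IsGloballyMinimal],
      ClassX11b W 3 → ¬ Ram W 3 → Surj W 3 → Three.HsiehDescentAt₃ W)
    -- CRUX 3 — … and the halves H2 ∧ H3 (value formula ∧ IMC divisibility at 3; H3 = deciding)
    (hHb : ∀ (W : WeierstrassCurve ℚ) [W.IsElliptic] [W.IsGloballyMinimal],
      ClassX11b W 3 → Ram W 3 → W.HasSplitMultiplicativeReductionAtPrime 3 →
        Three.BDPValueAt₃ W ∧ Three.IMCDivAt₃ W)
    (hHd : ∀ (W : WeierstrassCurve ℚ) [W.IsElliptic] [W.IsGloballyMinimal],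
      ClassX11b W 3 → ¬ Ram W 3 → Surj W 3 → Three.BDPValueAt₃ W ∧ Three.IMCDivAt₃ W)
    -- CRUX 4 — (T2♯-ℝ)₃ Shimura displays on split ∧ (ram) ∧ pure-β
    (hSh : ∀ (W : WeierstrassCurve ℚ) [W.IsElliptic] [W.IsGloballyMinimal],
      ClassX11b W 3 → Ram W 3 → W.HasSplitMultiplicativeReductionAtPrime 3 → ¬ Three.ShapeAlpha W →
        ¬ Three.ShapeGamma W → 3 ∣ W.tamagawaProduct → P2ShimuraDisplaysAt W 3)
    -- CRUX 5 — (T2′)₃ Euler-system halves (α, γ∖α split, ¬ram)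
    (hUα : ∀ (W : WeierstrassCurve ℚ) [W.IsElliptic] [W.IsGloballyMinimal],
      ClassX11b W 3 → Ram W 3 → Three.ShapeAlpha W → Typed.MissingUpperBoundAt W 3)
    (hUγ : ∀ (W : WeierstrassCurve ℚ) [W.IsElliptic] [W.IsGloballyMinimal],
      ClassX11b W 3 → Ram W 3 → W.HasSplitMultiplicativeReductionAtPrime 3 → ¬ Three.ShapeAlpha W →
        Three.ShapeGamma W → Typed.MissingUpperBoundAt W 3)
    (hU₀ : ∀ (W : WeierstrassCurve ℚ) [W.IsElliptic] [W.IsGloballyMinimal],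
      ClassX11b W 3 → Surj W 3 → ¬ Ram W 3 → Typed.MissingUpperBoundAt W 3)
    -- CRUX 6 — THE (T4″)₃ CORNER `¬Surj` (0 TRUE-OPEN classes; 296 class-pairs)
    (hCL : ∀ (W : WeierstrassCurve ℚ) [W.IsElliptic] [W.IsGloballyMinimal], Three.CornerStepLAt W)
    (hCT : ∀ (W : WeierstrassCurve ℚ) [W.IsElliptic] [W.IsGloballyMinimal], Three.CornerTwistAt W)
    (hCU : ∀ (W : WeierstrassCurve ℚ) [W.IsElliptic] [W.IsGloballyMinimal], Three.CornerUpperAt W) :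
    MultiplicativeRankOneAtThree :=
  fun W _ _ hX ↦
    Three.forall_bsdp_of_classRecord_v45' hGZ hKo hB hSk hWu hGZK hmod hnf hHL hMaz hPT hFH hBR hSkA
      hJn hHn hD hpar hMN hH hReg hDb hHb hSh hUα hUγ hDd hHd hU₀ hCL hCT hCU W hX

end Summit.BirchSwinnertonDyer.Rank1Residual.X11b

end
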